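import Mathlib.Algebra.Order.BigOperators.Group.Finset
import Mathlib.Tactic.LinearCombination
import Summits.CriticalPhenomena.PercolationContinuityZ3.Theorems.PercNearOneGluingNoHeavyLowerTailSahiCTCKleitmanPinnedPrep
import HarnessLib

/-!
# `NoHeavyLowerTail` (crux stmt-CriticalPhenomena-4575), P3 lane: the PINNED `t`-density of the Kleitman surplus

For up-sets `𝒳, 𝒵`, a sub-cube `(D, s)` with `t`-live traces, `#s = n + 1 ≥ 2t`, and a PINNED vertex `d ∈ s`, split the common
`t`-sets `W = csetsT 𝒳 𝒵 D s t` into the `g` through `d` and the `ε` avoiding `d`.  Then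

  `cH t n · C(n, t) · g + cH (t−1) n · C(n, t−1) · ε ≤ C(n, t−1) · C(n, t) · κ(D, s)`,

i.e. `κ ≥ cH t n / C(n,t−1) · g + cH (t−1) n / C(n,t) · ε`: a common `t`-set through the pinned vertex is worth about `n/t` times the
democratic `t`-DENSITY rate `cH t (n+1) / C(n+1, t)`, one avoiding it about `t/n` times that rate.  Equality at `H_t` and at the pair
`(H_t, d-cone)`.  Proof: peel a vertex `v ≠ d` chosen to maximise a linear functional of its two pinned degrees (maximum ≥ mean,
handshakes `Σ g_v = (t−1) g`, `Σ ε_v = t ε`), vertex recursion `κ ≥ κ(deletion) + κ(link)`, induction on `#s` for the deletion and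
on `t` for the link, and Pascal for `cH`; at the base `#s = 2t` the deletion (no complementary pairs) is counted by full local LYM
split at `d`.  This is the tool for the SPARSE regime of the rows `#dbl m ∈ {1, 2}` of the ladder `(L_3)`. [this work]
-/

namespace Summit.CriticalPhenomena.PercolationContinuityZ3.Theorems.SahiCTCForms

open Finset

variable {α : Type*} [DecidableEq α]

/-! ### The pinned `t`-density theorem -/

section PinnedT
variable {𝒳 𝒵 : Finset (Finset α)}

/-- **PINNED t-DENSITY** (level `t + 1`, all `#s = n + 1 ≥ 2(t+1)`): for up-sets `𝒳, 𝒵`, a sub-cube `(D, s)` with `(t+1)`-live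
traces and a pinned vertex `d ∈ s`,
`cH (t+1) n · C(n,t+1) · #{w ∈ W_{t+1} : d ∈ w} + cH t n · C(n,t) · #{w ∈ W_{t+1} : d ∉ w} ≤ C(n,t) · C(n,t+1) · κ(D, s)`.
Level `1` by integrality from `1`-DENSITY; level `t + 2` by peeling a vertex `v ≠ d` maximising the functional
`(P1 c0 c0' − P0 c1 c0') g_v + (Q1 c1 c0' − Q0 c0 c1) ε_v`, the vertex recursion, the inner induction (deletion) — at the base
`#s = 2(t+2)` full LYM split at `d` instead — the outer induction (link), and `pinnedT_step_arith`. [this work] -/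
theorem pinnedT_le_kap (h𝒳 : IsUpperSet (𝒳 : Set (Finset α))) (h𝒵 : IsUpperSet (𝒵 : Set (Finset α))) :
    ∀ (t n : ℕ) (D s : Finset α) (d : α), Disjoint D s → #s = n + 1 → d ∈ s → 2 * (t + 1) ≤ n + 1 →
      (∀ U ∈ tr 𝒳 D s, t + 1 ≤ #U) → (∀ U ∈ tr 𝒵 D s, t + 1 ≤ #U) →
      ((cH (t + 1) n * n.choose (t + 1) : ℕ) : ℤ) * #((csetsT 𝒳 𝒵 D s (t + 1)).filter fun w => d ∈ w)
        + ((cH t n * n.choose t : ℕ) : ℤ) * #((csetsT 𝒳 𝒵 D s (t + 1)).filter fun w => d ∉ w)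
        ≤ ((n.choose t * n.choose (t + 1) : ℕ) : ℤ) * kap 𝒳 𝒵 D s := by
  intro t
  induction t with
  | zero =>
    intro n D s d hDs hsn hd hn hX hZ
    show ((cH 1 n * n.choose 1 : ℕ) : ℤ) * #((csetsT 𝒳 𝒵 D s 1).filter fun w => d ∈ w)
        + ((cH 0 n * n.choose 0 : ℕ) : ℤ) * #((csetsT 𝒳 𝒵 D s 1).filter fun w => d ∉ w)
        ≤ ((n.choose 0 * n.choose 1 : ℕ) : ℤ) * kap 𝒳 𝒵 D s
    have hk : 0 ≤ kap 𝒳 𝒵 D s := kap_nonneg h𝒳 h𝒵 s D hDs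
    have h0 : cH 0 n = 0 := by unfold cH; simp
    have h1 : cH 1 n = 1 := by
      unfold cH; rw [show min 1 (n + 1 - 1) = 1 from by omega]; simp
    rw [h0, h1, Nat.choose_zero_right, Nat.choose_one_right, one_mul, zero_mul, Nat.cast_zero, zero_mul, add_zero]
    have hg1 : #((csetsT 𝒳 𝒵 D s 1).filter fun w => d ∈ w) ≤ 1 := by
      refine card_le_one.2 fun a ha b hb => ?_
      have ha' := mem_filter.1 ha
      have hb' := mem_filter.1 hb
      obtain ⟨-, hat, -, -⟩ := mem_csetsT.1 ha'.1
      obtain ⟨-, hbt, -, -⟩ := mem_csetsT.1 hb'.1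
      obtain ⟨x, hx⟩ := card_eq_one.1 hat
      obtain ⟨y, hy⟩ := card_eq_one.1 hbt
      have hxd : x = d := by have h := ha'.2; rw [hx, mem_singleton] at h; exact h.symm
      have hyd : y = d := by have h := hb'.2; rw [hy, mem_singleton] at h; exact h.symm
      rw [hx, hy, hxd, hyd]
    by_cases hg0 : #((csetsT 𝒳 𝒵 D s 1).filter fun w => d ∈ w) = 0
    · rw [hg0, Nat.cast_zero, mul_zero]; positivity
    · have hg : #((csetsT 𝒳 𝒵 D s 1).filter fun w => d ∈ w) = 1 := by omega
      have hdens := densityT_le_kap h𝒳 h𝒵 1 (n + 1) D s hDs hsn hX hZ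
      have hc1 : cH 1 (n + 1) = 1 := by unfold cH; rw [show min 1 (n + 1 + 1 - 1) = 1 from by omega]; simp
      rw [hc1, Nat.choose_one_right, Nat.cast_one, one_mul] at hdens
      have hW : (1 : ℤ) ≤ #(csetsT 𝒳 𝒵 D s 1) := by
        have h2 : 1 ≤ #(csetsT 𝒳 𝒵 D s 1) :=
          calc 1 = #((csetsT 𝒳 𝒵 D s 1).filter fun w => d ∈ w) := hg.symm
            _ ≤ #(csetsT 𝒳 𝒵 D s 1) := card_filter_le _ _
        exact_mod_cast h2
      have hk1 : 1 ≤ kap 𝒳 𝒵 D s := by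
        by_contra hlt
        have hle : kap 𝒳 𝒵 D s ≤ 0 := by omega
        have h3 : ((n + 1 : ℕ) : ℤ) * kap 𝒳 𝒵 D s ≤ ((n + 1 : ℕ) : ℤ) * 0 := mul_le_mul_of_nonneg_left hle (by positivity)
        linarith
      rw [hg, Nat.cast_one, mul_one]
      have h4 : (n : ℤ) * 1 ≤ (n : ℤ) * kap 𝒳 𝒵 D s := mul_le_mul_of_nonneg_left hk1 (by positivity)
      linarith
  | succ t iht =>
    intro n
    induction n using Nat.strong_induction_on with
    | _ n ih =>
    intro D s d hDs hsn hd hn hX hZ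
    have hdD : d ∉ D := fun h => (disjoint_left.1 hDs h) hd
    obtain ⟨m, hm⟩ : ∃ m, n = m + 1 := ⟨n - 1, by omega⟩
    have hmt : 2 * t + 2 ≤ m := by omega
    have hsv : ∀ v ∈ s, #(s.erase v) = m + 1 := fun v hv => by rw [card_erase_of_mem hv, hsn, hm, Nat.add_sub_cancel]
    have hDs' : ∀ v, Disjoint D (s.erase v) := fun v => Disjoint.mono_right (erase_subset v s) hDs
    have hDs'' : ∀ v ∈ s, Disjoint (insert v D) (s.erase v) := fun v _ => by
      rw [disjoint_insert_left]; exact ⟨notMem_erase v s, hDs' v⟩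
    have hX0 : ∀ v, ∀ U ∈ tr 𝒳 D (s.erase v), t + 1 + 1 ≤ #U := fun v U hU => hX U (mem_tr_erase_iff.1 hU).2
    have hZ0 : ∀ v, ∀ U ∈ tr 𝒵 D (s.erase v), t + 1 + 1 ≤ #U := fun v U hU => hZ U (mem_tr_erase_iff.1 hU).2
    have hX1 : ∀ v ∈ s, ∀ R ∈ tr 𝒳 (insert v D) (s.erase v), t + 1 ≤ #R := fun v hv R hR => by
      obtain ⟨hvR, hR'⟩ := (mem_tr_insert_iff hv).1 hR
      have h := hX _ hR'
      rw [card_insert_of_notMem hvR] at h; omega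
    have hZ1 : ∀ v ∈ s, ∀ R ∈ tr 𝒵 (insert v D) (s.erase v), t + 1 ≤ #R := fun v hv R hR => by
      obtain ⟨hvR, hR'⟩ := (mem_tr_insert_iff hv).1 hR
      have h := hZ _ hR'
      rw [card_insert_of_notMem hvR] at h; omega
    -- the deletion bound: inner induction, or full LYM at the base `#s = 2(t+2)`
    have hdel : ∃ P0 : ℕ, P0 + cH (t + 1) m = cH (t + 1 + 1) n ∧ ∀ v ∈ s.erase d,
        ((P0 * m.choose (t + 1 + 1) : ℕ) : ℤ) * #((csetsT 𝒳 𝒵 D (s.erase v) (t + 1 + 1)).filter fun w => d ∈ w)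
          + ((cH (t + 1) m * m.choose (t + 1) : ℕ) : ℤ) * #((csetsT 𝒳 𝒵 D (s.erase v) (t + 1 + 1)).filter fun w => d ∉ w)
          ≤ ((m.choose (t + 1) * m.choose (t + 1 + 1) : ℕ) : ℤ) * kap 𝒳 𝒵 D (s.erase v) := by
      by_cases hbase : n = 2 * t + 3
      · have hm2 : m = 2 * (t + 1) := by omega
        refine ⟨∑ j ∈ range (t + 1 + 1), m.choose j, ?_, fun v hv => ?_⟩
        · rw [hm2, hbase, show 2 * t + 3 = 2 * (t + 1) + 1 from by ring]
          exact (cH_succ_two_mul_succ (t + 1)).symm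
        · have hvs : v ∈ s := mem_of_mem_erase hv
          have hvd : v ≠ d := ne_of_mem_erase hv
          have hds' : d ∈ s.erase v := mem_erase.2 ⟨hvd.symm, hd⟩
          have hlt : #(s.erase v) < 2 * (t + 1 + 1) := by rw [hsv v hvs]; omega
          have hkap := kap_eq_card_inter_of_lt_two_mul (hX0 v) (hZ0 v) hlt
          have hsplit := (card_filter_add_card_filter_not (s := tr 𝒳 D (s.erase v) ∩ tr 𝒵 D (s.erase v)) (fun U => d ∈ U)).symm
          have hp1 := card_link_inter_le_card_filter_mem (𝒳 := 𝒳) (𝒵 := 𝒵) (D := D) hds'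
          have hp0 := card_inter_filter_not_mem_eq (𝒳 := 𝒳) (𝒵 := 𝒵) (D := D) (s := s.erase v) d
          have hs'' : #((s.erase v).erase d) = m := by rw [card_erase_of_mem hds', hsv v hvs, Nat.add_sub_cancel]
          have hL1 := lym_mul_card_le_card_inter (𝒳 := 𝒳) (𝒵 := 𝒵) (D := insert d D) (s := (s.erase v).erase d) (t := t + 1) h𝒳 h𝒵
          have hL0 := lym_mul_card_le_card_inter (𝒳 := 𝒳) (𝒵 := 𝒵) (D := D) (s := (s.erase v).erase d) (t := t + 1 + 1) h𝒳 h𝒵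
          rw [hs'', show m + 1 - (t + 1) = t + 1 + 1 from by omega] at hL1
          rw [hs'', show m + 1 - (t + 1 + 1) = t + 1 from by omega] at hL0
          have hg0 := card_filter_mem_le_card_csetsT_insert (𝒳 := 𝒳) (𝒵 := 𝒵) (D := D) (s := s.erase v) (t := t + 1 + 1) d
          rw [Nat.add_sub_cancel] at hg0
          have he0 : #(csetsT 𝒳 𝒵 D ((s.erase v).erase d) (t + 1 + 1))
              = #((csetsT 𝒳 𝒵 D (s.erase v) (t + 1 + 1)).filter fun w => d ∉ w) := by rw [csetsT_erase]
          have hQ0 : cH (t + 1) m = ∑ j ∈ range (t + 1), m.choose j := by rw [hm2]; exact cH_two_mul (t + 1)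
          set P0 := ∑ j ∈ range (t + 1 + 1), m.choose j with hP0
          set Q0 := ∑ j ∈ range (t + 1), m.choose j with hQ0'
          set A := #((tr 𝒳 D (s.erase v) ∩ tr 𝒵 D (s.erase v)).filter fun U => d ∈ U) with hA
          set B := #((tr 𝒳 D (s.erase v) ∩ tr 𝒵 D (s.erase v)).filter fun U => d ∉ U) with hB
          set g0 := #((csetsT 𝒳 𝒵 D (s.erase v) (t + 1 + 1)).filter fun w => d ∈ w) with hg0'
          set e0 := #((csetsT 𝒳 𝒵 D (s.erase v) (t + 1 + 1)).filter fun w => d ∉ w) with he0'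
          have hAb : P0 * g0 ≤ m.choose (t + 1) * A :=
            calc P0 * g0 ≤ P0 * #(csetsT 𝒳 𝒵 (insert d D) ((s.erase v).erase d) (t + 1)) := Nat.mul_le_mul_left _ hg0
              _ ≤ m.choose (t + 1) * #(tr 𝒳 (insert d D) ((s.erase v).erase d) ∩ tr 𝒵 (insert d D) ((s.erase v).erase d)) := hL1
              _ ≤ m.choose (t + 1) * A := Nat.mul_le_mul_left _ hp1
          have hBb : Q0 * e0 ≤ m.choose (t + 1 + 1) * B := by
            have h := hL0
            rw [he0, ← hp0] at h
            exact h
          have hA' := Nat.mul_le_mul_right (m.choose (t + 1 + 1)) hAb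
          have hB' := Nat.mul_le_mul_right (m.choose (t + 1)) hBb
          rw [hkap, hsplit, hQ0]
          push_cast
          have hA'' : ((P0 * g0 * m.choose (t + 1 + 1) : ℕ) : ℤ) ≤ ((m.choose (t + 1) * A * m.choose (t + 1 + 1) : ℕ) : ℤ) := by
            exact_mod_cast hA'
          have hB'' : ((Q0 * e0 * m.choose (t + 1) : ℕ) : ℤ) ≤ ((m.choose (t + 1 + 1) * B * m.choose (t + 1) : ℕ) : ℤ) := by
            exact_mod_cast hB'
          push_cast at hA'' hB''
          linarith
      · refine ⟨cH (t + 1 + 1) m, ?_, fun v hv => ?_⟩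
        · rw [hm]; exact (cH_pascal (t + 1 + 1) m (by omega) (by omega)).symm
        · have hvs : v ∈ s := mem_of_mem_erase hv
          have hvd : v ≠ d := ne_of_mem_erase hv
          have hds' : d ∈ s.erase v := mem_erase.2 ⟨hvd.symm, hd⟩
          exact ih m (by omega) D (s.erase v) d (hDs' v) (hsv v hvs) hds' (by omega) (hX0 v) (hZ0 v)
    obtain ⟨P0, hP0, hdelv⟩ := hdel
    -- the functional and the peeled vertex
    set ca : ℤ := (cH (t + 1) m : ℤ) * (m.choose (t + 1) : ℤ) * (m.choose (t + 1 + 1) : ℤ)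
        - (P0 : ℤ) * (m.choose t : ℤ) * (m.choose (t + 1 + 1) : ℤ) with hca
    set cb : ℤ := (cH t m : ℤ) * (m.choose t : ℤ) * (m.choose (t + 1 + 1) : ℤ)
        - (cH (t + 1) m : ℤ) * (m.choose (t + 1) : ℤ) * (m.choose t : ℤ) with hcb
    set F : α → ℤ := fun u =>
        ca * (#(((csetsT 𝒳 𝒵 D s (t + 1 + 1)).filter fun w => d ∈ w).filter fun w => u ∈ w) : ℤ)
          + cb * (#(((csetsT 𝒳 𝒵 D s (t + 1 + 1)).filter fun w => d ∉ w).filter fun w => u ∈ w) : ℤ) with hF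
    have hsne : (s.erase d).Nonempty := by rw [← card_pos, card_erase_of_mem hd, hsn]; omega
    have hcard : #(s.erase d) = n := by rw [card_erase_of_mem hd, hsn, Nat.add_sub_cancel]
    obtain ⟨v, hv, hFv⟩ : ∃ v ∈ s.erase d, (∑ u ∈ s.erase d, F u) ≤ (n : ℤ) * F v := by
      refine exists_le_of_sum_le hsne ?_
      rw [sum_const, hcard, nsmul_eq_mul, ← mul_sum]
    have hsum : ∑ u ∈ s.erase d, F u
        = ca * (((t + 1) * #((csetsT 𝒳 𝒵 D s (t + 1 + 1)).filter fun w => d ∈ w) : ℕ) : ℤ)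
          + cb * (((t + 1 + 1) * #((csetsT 𝒳 𝒵 D s (t + 1 + 1)).filter fun w => d ∉ w) : ℕ) : ℤ) := by
      rw [← sum_pinned_degree_eq (𝒳 := 𝒳) (𝒵 := 𝒵) (D := D) (s := s) (t := t + 1) (d := d),
        ← sum_unpinned_degree_eq (𝒳 := 𝒳) (𝒵 := 𝒵) (D := D) (s := s) (t := t + 1) (d := d)]
      push_cast
      rw [hF]
      simp only [sum_add_distrib, mul_sum]
    have hvs : v ∈ s := mem_of_mem_erase hv
    have hvd : v ≠ d := ne_of_mem_erase hv
    have hvD : v ∉ D := fun h => (disjoint_left.1 hDs h) hvs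
    have hds' : d ∈ s.erase v := mem_erase.2 ⟨hvd.symm, hd⟩
    -- vertex recursion
    have hrec := kap_rec (𝒳 := 𝒳) (𝒵 := 𝒵) (D := D) h𝒳 h𝒵 hvs hvD
    have hχ : (0 : ℤ) ≤ #((tr 𝒳 (insert v D) (s.erase v) \ tr 𝒳 D (s.erase v)).filter fun R =>
        s.erase v \ R ∈ tr 𝒵 (insert v D) (s.erase v) ∧ s.erase v \ R ∉ tr 𝒵 D (s.erase v)) := Nat.cast_nonneg _
    have hk : kap 𝒳 𝒵 D (s.erase v) + kap 𝒳 𝒵 (insert v D) (s.erase v) ≤ kap 𝒳 𝒵 D s := by rw [hrec]; linarith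
    -- deletion bound at v
    have hgx := card_filter_csetsT_eq_erase_add (𝒳 := 𝒳) (𝒵 := 𝒵) (D := D) (s := s) (t := t + 1 + 1) v (fun w => d ∈ w)
    have hey := card_filter_csetsT_eq_erase_add (𝒳 := 𝒳) (𝒵 := 𝒵) (D := D) (s := s) (t := t + 1 + 1) v (fun w => d ∉ w)
    have h0 := hdelv v hv
    -- link bound at v
    have hI := iht m (insert v D) (s.erase v) d (hDs'' v hvs) (hsv v hvs) hds' (by omega) (hX1 v hvs) (hZ1 v hvs)
    have hx1 : #((((csetsT 𝒳 𝒵 D s (t + 1 + 1)).filter fun w => d ∈ w)).filter fun w => v ∈ w)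
        ≤ #((csetsT 𝒳 𝒵 (insert v D) (s.erase v) (t + 1)).filter fun w => d ∈ w) :=
      card_filter_filter_mem_le_link (t := t + 1) (fun w => d ∈ w) fun w hw => mem_erase.2 ⟨hvd.symm, hw⟩
    have hy1 : #((((csetsT 𝒳 𝒵 D s (t + 1 + 1)).filter fun w => d ∉ w)).filter fun w => v ∈ w)
        ≤ #((csetsT 𝒳 𝒵 (insert v D) (s.erase v) (t + 1)).filter fun w => d ∉ w) :=
      card_filter_filter_mem_le_link (t := t + 1) (fun w => d ∉ w) fun w hw h => hw (mem_of_mem_erase h)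
    -- binomial identities
    have i2n : n * m.choose t = (t + 1) * n.choose (t + 1) := by rw [hm, Nat.add_one_mul_choose_eq, mul_comm]
    have i4n : n * m.choose (t + 1) = (t + 1 + 1) * n.choose (t + 1 + 1) := by rw [hm, Nat.add_one_mul_choose_eq, mul_comm]
    have i3n : n * m.choose (t + 1 + 1) = (n - (t + 1 + 1)) * n.choose (t + 1 + 1) := by
      rw [hm, Nat.add_one_mul_choose_eq, Nat.choose_succ_right_eq, mul_comm]
    have i1n : (n - (t + 1)) * n.choose (t + 1) = (t + 1 + 1) * n.choose (t + 1 + 1) := by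
      rw [mul_comm, ← Nat.choose_succ_right_eq, mul_comm]
    have hsub1 : t + 1 ≤ n := by omega
    have hsub2 : t + 1 + 1 ≤ n := by omega
    have i1 : ((n : ℤ) - ((t : ℤ) + 1)) * (n.choose (t + 1) : ℤ) = ((t : ℤ) + 1 + 1) * (n.choose (t + 1 + 1) : ℤ) := by
      have h := congrArg (fun k : ℕ => (k : ℤ)) i1n; push_cast [hsub1] at h; linarith
    have i2 : (n : ℤ) * (m.choose t : ℤ) = ((t : ℤ) + 1) * (n.choose (t + 1) : ℤ) := by exact_mod_cast i2n
    have i3 : (n : ℤ) * (m.choose (t + 1 + 1) : ℤ) = ((n : ℤ) - ((t : ℤ) + 1) - 1) * (n.choose (t + 1 + 1) : ℤ) := by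
      have h := congrArg (fun k : ℕ => (k : ℤ)) i3n; push_cast [hsub2] at h; linarith
    have i4 : (n : ℤ) * (m.choose (t + 1) : ℤ) = ((t : ℤ) + 1 + 1) * (n.choose (t + 1 + 1) : ℤ) := by exact_mod_cast i4n
    have hKpos : (0 : ℤ) < (n.choose (t + 1 + 1) : ℤ) := by exact_mod_cast Nat.choose_pos hsub2
    have hnt : (0 : ℤ) < (n : ℤ) - ((t : ℤ) + 1) - 1 := by
      have h : 2 * t + 3 ≤ n := by omega
      have h' : ((2 * t + 3 : ℕ) : ℤ) ≤ (n : ℤ) := by exact_mod_cast h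
      push_cast at h'; linarith
    have hD : (0 : ℤ) < ((t : ℤ) + 1) * ((t : ℤ) + 1 + 1) * ((n : ℤ) - ((t : ℤ) + 1) - 1) * (n.choose (t + 1 + 1) : ℤ) :=
      mul_pos (mul_pos (by positivity) hnt) hKpos
    -- assemble the hypotheses of the arithmetic step
    have h0' : (P0 : ℤ) * (m.choose (t + 1 + 1) : ℤ)
          * ((#((csetsT 𝒳 𝒵 D s (t + 1 + 1)).filter fun w => d ∈ w) : ℤ)
              - #((((csetsT 𝒳 𝒵 D s (t + 1 + 1)).filter fun w => d ∈ w)).filter fun w => v ∈ w))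
        + (cH (t + 1) m : ℤ) * (m.choose (t + 1) : ℤ)
          * ((#((csetsT 𝒳 𝒵 D s (t + 1 + 1)).filter fun w => d ∉ w) : ℤ)
              - #((((csetsT 𝒳 𝒵 D s (t + 1 + 1)).filter fun w => d ∉ w)).filter fun w => v ∈ w))
        ≤ (m.choose (t + 1) : ℤ) * (m.choose (t + 1 + 1) : ℤ) * kap 𝒳 𝒵 D (s.erase v) := by
      have eg : ((#((csetsT 𝒳 𝒵 D (s.erase v) (t + 1 + 1)).filter fun w => d ∈ w) : ℕ) : ℤ)
          = (#((csetsT 𝒳 𝒵 D s (t + 1 + 1)).filter fun w => d ∈ w) : ℤ)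
              - #((((csetsT 𝒳 𝒵 D s (t + 1 + 1)).filter fun w => d ∈ w)).filter fun w => v ∈ w) := by
        rw [hgx]; push_cast; ring
      have ee : ((#((csetsT 𝒳 𝒵 D (s.erase v) (t + 1 + 1)).filter fun w => d ∉ w) : ℕ) : ℤ)
          = (#((csetsT 𝒳 𝒵 D s (t + 1 + 1)).filter fun w => d ∉ w) : ℤ)
              - #((((csetsT 𝒳 𝒵 D s (t + 1 + 1)).filter fun w => d ∉ w)).filter fun w => v ∈ w) := by
        rw [hey]; push_cast; ring
      rw [← eg, ← ee]; push_cast at h0 ⊢; linarith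
    have h1' : (cH (t + 1) m : ℤ) * (m.choose (t + 1) : ℤ)
          * (#((((csetsT 𝒳 𝒵 D s (t + 1 + 1)).filter fun w => d ∈ w)).filter fun w => v ∈ w) : ℤ)
        + (cH t m : ℤ) * (m.choose t : ℤ)
          * (#((((csetsT 𝒳 𝒵 D s (t + 1 + 1)).filter fun w => d ∉ w)).filter fun w => v ∈ w) : ℤ)
        ≤ (m.choose t : ℤ) * (m.choose (t + 1) : ℤ) * kap 𝒳 𝒵 (insert v D) (s.erase v) := by
      have m1 := mul_le_mul_of_nonneg_left (show ((#((((csetsT 𝒳 𝒵 D s (t + 1 + 1)).filter fun w => d ∈ w)).filter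
          fun w => v ∈ w) : ℕ) : ℤ) ≤ #((csetsT 𝒳 𝒵 (insert v D) (s.erase v) (t + 1)).filter fun w => d ∈ w) by exact_mod_cast hx1)
        (show (0 : ℤ) ≤ (cH (t + 1) m : ℤ) * (m.choose (t + 1) : ℤ) by positivity)
      have m2 := mul_le_mul_of_nonneg_left (show ((#((((csetsT 𝒳 𝒵 D s (t + 1 + 1)).filter fun w => d ∉ w)).filter
          fun w => v ∈ w) : ℕ) : ℤ) ≤ #((csetsT 𝒳 𝒵 (insert v D) (s.erase v) (t + 1)).filter fun w => d ∉ w) by exact_mod_cast hy1)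
        (show (0 : ℤ) ≤ (cH t m : ℤ) * (m.choose t : ℤ) by positivity)
      push_cast at hI
      linarith
    have hmax : ((t : ℤ) + 1) * ca * (#((csetsT 𝒳 𝒵 D s (t + 1 + 1)).filter fun w => d ∈ w) : ℤ)
        + ((t : ℤ) + 1 + 1) * cb * (#((csetsT 𝒳 𝒵 D s (t + 1 + 1)).filter fun w => d ∉ w) : ℤ)
        ≤ (n : ℤ) * (ca * (#((((csetsT 𝒳 𝒵 D s (t + 1 + 1)).filter fun w => d ∈ w)).filter fun w => v ∈ w) : ℤ)
          + cb * (#((((csetsT 𝒳 𝒵 D s (t + 1 + 1)).filter fun w => d ∉ w)).filter fun w => v ∈ w) : ℤ)) := by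
      have h := hFv
      rw [hsum, hF] at h
      push_cast at h
      linarith
    have key := pinnedT_step_arith (kap 𝒳 𝒵 D s) (kap 𝒳 𝒵 D (s.erase v)) (kap 𝒳 𝒵 (insert v D) (s.erase v))
      (#((csetsT 𝒳 𝒵 D s (t + 1 + 1)).filter fun w => d ∈ w) : ℤ) (#((csetsT 𝒳 𝒵 D s (t + 1 + 1)).filter fun w => d ∉ w) : ℤ)
      (#((((csetsT 𝒳 𝒵 D s (t + 1 + 1)).filter fun w => d ∈ w)).filter fun w => v ∈ w) : ℤ)
      (#((((csetsT 𝒳 𝒵 D s (t + 1 + 1)).filter fun w => d ∉ w)).filter fun w => v ∈ w) : ℤ)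
      (n : ℤ) ((t : ℤ) + 1) (P0 : ℤ) (cH (t + 1) m : ℤ) (cH (t + 1) m : ℤ) (cH t m : ℤ)
      (m.choose (t + 1) : ℤ) (m.choose (t + 1 + 1) : ℤ) (m.choose t : ℤ) (n.choose (t + 1) : ℤ) (n.choose (t + 1 + 1) : ℤ)
      ca cb hk h0' h1' hca hcb hmax i1 i2 i3 i4 (Nat.cast_nonneg _) (Nat.cast_nonneg _) (by positivity) (Nat.cast_nonneg _) hD
    -- Pascal
    have hQ : cH (t + 1) n = cH (t + 1) m + cH t m := by rw [hm]; exact cH_pascal (t + 1) m (by omega) (by omega)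
    rw [← hP0, hQ]
    push_cast
    linarith

end PinnedT

end Summit.CriticalPhenomena.PercolationContinuityZ3.Theorems.SahiCTCForms
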